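import Summits.BirchSwinnertonDyer.Rank1Residual.Additive.SemistabilityDefectRamification
import HarnessLib

/-!
# X3♯/X4♯ at a potentially good `p ≥ 5`: `E_F` is good at `w ∣ p` IFF the semistability defect divides `e(w|p)`

HONEST FRAMING (cell `b2b-bsdres`, run/shared/lean/b2b/bsd-rank1-residual/, verbatim in every
file): the goal of the cell is to DELETE the COMBINATION-SHAPED residual classes of the
Birch–Swinnerton-Dyer formula for ALL analytic-rank `≤ 1` elliptic curves over `ℚ` — "full BSD
formula for every rank `≤ 1` curve in class `C`" assembled STRICTLY from published theorems — so
that the rank-`≤ 1` remainder becomes exactly the CONSTRUCTION-SHAPED classes, which are TYPED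
(missing-input `Prop`s), NOT attempted. This is not "finishing BSD". Sub-cell `additive-p2`
(CLASS-OWNERS row "X3/X4 additive — pot. good ordinary / X3♯(G-ord)"), generation 4: research
route; no claim beyond the stated classes; theorems only, no definition, no new named fact;
X3♯(G-ord)/X4♯(G-ord) stay CONSTRUCTION-SHAPED.

WHAT THIS FILE DOES. The complete LOCAL CRITERION for the base-change-and-descend route at a
potentially good prime `p ≥ 5` (`ord_p j(E) ≥ 0`), for ANY number field `F` and ANY place `w ∋ p`:

* **`hasGoodReductionAt_baseChange_iff_semistabilityIndex_dvd`** —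
  `(W.baseChange F).HasGoodReductionAt w ↔ semistabilityIndex W p ∣ e(w|p)`, where
  `semistabilityIndex W p = 12 / gcd(12, ord_p Δ_min) ∈ {1,2,3,4,6}` is additive-p4's census index
  (Serre–Tate / Kraus: the order of the image of inertia) and `e(w|p)` the ramification index
  (`(Ideal.span {p}).ramificationIdx' w.asIdeal`). (⇒) is gen 4's
  `semistabilityIndex_dvd_ramificationIdx_of_hasGoodReductionAt` (`SemistabilityDefectRamification.lean`);
  (⇐): `ord_w Δ = e(w|p)·ord_p Δ_min ∈ 12ℤ` (Mathlib `valuation_liesOver`), a uniformizer power `δ`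
  has `w(δ)¹² = w(Δ)`, `w(j) ≤ 1`, and gen 2's valuation criterion
  `hasGoodReductionAt_of_valuation_j_le_one_of_valuation_pow_twelve` (Silverman *AEC* VII.5.1(a),
  residue characteristic `≥ 5`) gives good reduction. Gen 2's `typeG_of_padicValRat_j_nonneg_of_twelve_dvd`
  is the special case `F = ℚ(ζ_p)`, `e(w|p) = p − 1`.
* `isSemistableAt_baseChange_iff_semistabilityIndex_dvd` — the same with "semistable"
  (multiplicative reduction never occurs above a potentially good prime,
  `not_hasMultiplicativeReductionAt_baseChange_of_padicValRat_j_nonneg`).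
* `hasGoodReductionAt_baseChange_iff_of_ramificationIdx_eq_two` — at a place with `e(w|p) = 2`
  (e.g. the prime above `p` of a quadratic field ramified at `p`, `K = ℚ(√p*)`): `E_K` good at `w`
  ⟺ `e_E(p) ∣ 2` ⟺ `6 ∣ ord_p Δ_min` (good or Kodaira `I₀*`): the defect-2 cell of
  `GordDescent*.lean` is EXACTLY the domain of the quadratic descent.
* `hasGoodReductionAt_baseChange_of_semistabilityIndex_dvd_ramificationIdx` — the (⇐) half alone,
  valid for EVERY `F` (not only subfields of `ℚ(ζ_p)`): any extension with `e_E(p) ∣ e(w|p)`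
  semistabilises `E` at `w` — the fields available to a future over-`F` input for the
  `e ∈ {3,4,6}` cell (cubic/quartic/sextic ramification; AUDIT-X34-GORD.md §4 R2′).

References: J. H. Silverman, *AEC* VII.5.1, VII.1.3; J.-P. Serre, J. Tate, Ann. of Math. 88 (1968)
§2; A. Kraus, Manuscripta Math. 69 (1990); D. Delbourgo, Compositio Math. 113 (1998) §1.2 Lemma.
-/

noncomputable section

open scoped Classical NumberField

open WeierstrassCurve IsDedekindDomain IsDedekindDomain.HeightOneSpectrum NumberField
  Rat.HeightOneSpectrum Literature.NumberTheory.EllipticCurves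
  Literature.NumberTheory.EllipticCurves.Rank1Residual

namespace Summit.BirchSwinnertonDyer.Rank1Residual.Additive

variable (W : WeierstrassCurve ℚ) [W.IsElliptic] [W.IsGloballyMinimal] (p : ℕ) [hp : Fact p.Prime]
  (F : Type) [Field F] [NumberField F] (w : HeightOneSpectrum (𝓞 F))

/-- **Any extension with `e_E(p) ∣ e(w|p)` makes `E` good at `w`** (`p ≥ 5`, `ord_p j ≥ 0`, any
number field `F`, any `w ∋ p`): `ord_w Δ = e(w|p)·ord_p Δ_min ∈ 12ℤ`, so a uniformizer power `δ`
has `w(δ)¹² = w(Δ)`; `w(j) ≤ 1`; residue characteristic `p ≥ 5`; gen 2's valuation criterion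
`hasGoodReductionAt_of_valuation_j_le_one_of_valuation_pow_twelve`. Silverman *AEC* VII.5.1(a). -/
theorem hasGoodReductionAt_baseChange_of_semistabilityIndex_dvd_ramificationIdx (hp5 : 5 ≤ p)
    (hj : 0 ≤ padicValRat p W.j) (hw : (p : 𝓞 F) ∈ w.asIdeal)
    (hdvd : semistabilityIndex W p ∣ (Ideal.span {(p : ℤ)}).ramificationIdx' w.asIdeal) :
    (W.baseChange F).HasGoodReductionAt w := by
  -- the place of `ℤ` below `w` is `(p)`
  set v : HeightOneSpectrum ℤ := (Rat.HeightOneSpectrum.primesEquiv (R := ℤ)).symm ⟨p, hp.out⟩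
    with hvdef
  have hv : Rat.HeightOneSpectrum.natGenerator v = p :=
    congrArg Subtype.val ((Rat.HeightOneSpectrum.primesEquiv (R := ℤ)).apply_symm_apply ⟨p, hp.out⟩)
  have hvspan : v.asIdeal = Ideal.span {(p : ℤ)} := by
    rw [Rat.HeightOneSpectrum.asIdeal_eq_span_natGenerator_int, hv]
  haveI hlies' : w.asIdeal.LiesOver (Ideal.span {(p : ℤ)}) := liesOver_span_of_natCast_mem p F w hw
  haveI hlies : w.asIdeal.LiesOver v.asIdeal := by rw [hvspan]; exact hlies'
  have hunder : w.asIdeal.under ℤ = v.asIdeal := hlies.over.symm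
  -- `2, 3 ∉ w`
  have hnotMem : ∀ q : ℕ, q < p → q ≠ 0 → (q : 𝓞 F) ∉ w.asIdeal := by
    intro q hq hq0 hmem
    have h1 : (q : ℤ) ∈ w.asIdeal.under ℤ := by
      rw [Ideal.under_def, Ideal.mem_comap, map_natCast]; exact hmem
    rw [hunder, hvspan, Ideal.mem_span_singleton] at h1
    have h2 : p ∣ q := by exact_mod_cast h1
    exact absurd (Nat.le_of_dvd (Nat.pos_of_ne_zero hq0) h2) (not_le.mpr hq)
  have h2 : (2 : 𝓞 F) ∉ w.asIdeal := by simpa using hnotMem 2 (by omega) two_ne_zero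
  have h3 : (3 : 𝓞 F) ∉ w.asIdeal := by simpa using hnotMem 3 (by omega) three_ne_zero
  -- the curve upstairs
  haveI : (W.baseChange F).IsElliptic := by rw [baseChange]; infer_instance
  have hjF : (W.baseChange F).j = algebraMap ℚ F W.j := W.map_j (algebraMap ℚ F)
  have hΔF : (W.baseChange F).Δ = algebraMap ℚ F W.Δ := by rw [baseChange, map_Δ]
  -- `w(j) ≤ 1`
  have hjw : w.valuation F (W.baseChange F).j ≤ 1 := by
    rw [hjF, ← valuation_liesOver (K := ℚ) (L := F) v w W.j]
    apply pow_le_one₀ zero_le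
    by_cases hj0 : W.j = 0
    · rw [hj0, map_zero]; exact zero_le
    rw [Rat.HeightOneSpectrum.valuation_eq_exp_neg_padicValRat v hj0, hv, ← WithZero.exp_zero,
      WithZero.exp_le_exp]
    linarith
  -- `12 ∣ e(w|p)·ord_p Δ_min`
  have h12 : 12 ∣ (Ideal.span {(p : ℤ)}).ramificationIdx' w.asIdeal *
      padicValInt p W.minimalDiscriminantInt :=
    (semistabilityIndex_dvd_iff_twelve_dvd_mul W p _).mp hdvd
  obtain ⟨k, hk⟩ := h12
  -- `w(Δ) = exp(−12 k)`
  have hΔ0 : W.Δ ≠ 0 := W.isUnit_Δ.ne_zero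
  have hvΔ : w.valuation F (W.baseChange F).Δ = WithZero.exp (-(12 * (k : ℤ))) := by
    rw [hΔF, ← valuation_liesOver (K := ℚ) (L := F) v w W.Δ,
      Rat.HeightOneSpectrum.valuation_eq_exp_neg_padicValRat v hΔ0, hv, ← WithZero.exp_nsmul,
      padicValRat_Δ_eq W p, hvspan]
    congr 1
    have hk' : ((Ideal.span {(p : ℤ)}).ramificationIdx' w.asIdeal : ℤ) *
        (padicValInt p W.minimalDiscriminantInt : ℤ) = 12 * (k : ℤ) := by exact_mod_cast hk
    rw [nsmul_eq_mul, mul_neg, hk']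
  -- a uniformizer power `δ = π^k` with `w(δ)¹² = w(Δ)`
  obtain ⟨π, hπ⟩ := w.valuation_exists_uniformizer F
  have hδ : w.valuation F (π ^ k) ^ 12 = w.valuation F (W.baseChange F).Δ := by
    rw [hvΔ, map_pow, hπ, ← pow_mul, ← WithZero.exp_nsmul]
    congr 1
    simp only [nsmul_eq_mul]
    push_cast
    ring
  exact hasGoodReductionAt_of_valuation_j_le_one_of_valuation_pow_twelve (W.baseChange F) h2 h3 hjw hδ

/-- **THE LOCAL CRITERION** (`p ≥ 5`, `ord_p j(E) ≥ 0`, `W` globally minimal, any number field `F`,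
any place `w ∋ p`): **`E_F` has good reduction at `w` iff `semistabilityIndex W p ∣ e(w|p)`.**
(⇒) `semistabilityIndex_dvd_ramificationIdx_of_hasGoodReductionAt`; (⇐)
`hasGoodReductionAt_baseChange_of_semistabilityIndex_dvd_ramificationIdx`. For `p ≥ 5` the index
is the order `e ∈ {1,2,3,4,6}` of the (cyclic, tame) image of inertia on `E[ℓ]` and the criterion is
Serre–Tate's "good reduction over `F_w` iff inertia of `F_w` kills it"; here it is pure valuation
theory. [cite: SilvermanAEC2009, Prop. VII.5.1(b)] -/
theorem hasGoodReductionAt_baseChange_iff_semistabilityIndex_dvd (hp5 : 5 ≤ p)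
    (hj : 0 ≤ padicValRat p W.j) (hw : (p : 𝓞 F) ∈ w.asIdeal) :
    (W.baseChange F).HasGoodReductionAt w ↔
      semistabilityIndex W p ∣ (Ideal.span {(p : ℤ)}).ramificationIdx' w.asIdeal :=
  ⟨semistabilityIndex_dvd_ramificationIdx_of_hasGoodReductionAt W p F w hw,
    hasGoodReductionAt_baseChange_of_semistabilityIndex_dvd_ramificationIdx W p F w hp5 hj hw⟩

/-- **Semistable version**: at a potentially good `p ≥ 5`, `E_F` is semistable at `w ∋ p` iff
`semistabilityIndex W p ∣ e(w|p)` (multiplicative reduction never occurs above `p`: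
`not_hasMultiplicativeReductionAt_baseChange_of_padicValRat_j_nonneg`).
[cite: SilvermanAEC2009, Prop. VII.5.1(b)] -/
theorem isSemistableAt_baseChange_iff_semistabilityIndex_dvd (hp5 : 5 ≤ p)
    (hj : 0 ≤ padicValRat p W.j) (hw : (p : 𝓞 F) ∈ w.asIdeal) :
    (W.baseChange F).IsSemistableAt w ↔
      semistabilityIndex W p ∣ (Ideal.span {(p : ℤ)}).ramificationIdx' w.asIdeal := by
  refine ⟨fun hss ↦ (semistabilityIndex_dvd_ramificationIdx_of_isSemistableAt W p F w hj hw hss).2,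
    fun h ↦ Or.inl ?_⟩
  exact hasGoodReductionAt_baseChange_of_semistabilityIndex_dvd_ramificationIdx W p F w hp5 hj hw h

/-- **At a place with `e(w|p) = 2`** (e.g. the prime above `p` in a quadratic field ramified at `p`,
such as `K = ℚ(√p*)` of the defect-2 descent): `E_F` is good at `w` iff `semistabilityIndex W p ∣ 2`
iff `6 ∣ ord_p Δ_min` — i.e. iff `E` is good at `p` (`e = 1`) or of Kodaira type `I₀*` (`e = 2`) at
`p ≥ 5`. The quadratic descent of `GordDescent*.lean` therefore has EXACTLY the defect-2 cell as its
domain among the additive potentially-good pairs. [cite: SilvermanAEC2009, Prop. VII.5.1(b)] -/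
theorem hasGoodReductionAt_baseChange_iff_of_ramificationIdx_eq_two (hp5 : 5 ≤ p)
    (hj : 0 ≤ padicValRat p W.j) (hw : (p : 𝓞 F) ∈ w.asIdeal)
    (he2 : (Ideal.span {(p : ℤ)}).ramificationIdx' w.asIdeal = 2) :
    (W.baseChange F).HasGoodReductionAt w ↔ 6 ∣ padicValInt p W.minimalDiscriminantInt := by
  rw [hasGoodReductionAt_baseChange_iff_semistabilityIndex_dvd W p F w hp5 hj hw, he2,
    semistabilityIndex_dvd_two_iff]

/-- The same at `e(w|p) = 2` in terms of the index: good at `w` iff `semistabilityIndex W p ∣ 2`.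
[cite: SilvermanAEC2009, Prop. VII.5.1(b)] -/
theorem hasGoodReductionAt_baseChange_iff_dvd_two_of_ramificationIdx_eq_two (hp5 : 5 ≤ p)
    (hj : 0 ≤ padicValRat p W.j) (hw : (p : 𝓞 F) ∈ w.asIdeal)
    (he2 : (Ideal.span {(p : ℤ)}).ramificationIdx' w.asIdeal = 2) :
    (W.baseChange F).HasGoodReductionAt w ↔ semistabilityIndex W p ∣ 2 := by
  rw [hasGoodReductionAt_baseChange_iff_semistabilityIndex_dvd W p F w hp5 hj hw, he2]

/-- **Additive at `p`, good above**: for an ADDITIVE potentially good `p ≥ 5` (`Addv W p`,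
`ord_p j ≥ 0`) and `E_F` good at `w ∋ p`, the ramification index `e(w|p)` is a multiple of
`semistabilityIndex W p ≥ 2` — in particular `e(w|p) ≥ 2` (gen 0's `ramificationIdxIn_ne_one_…` in
sharp form) and, on the `e ∈ {3,4,6}` cell, `e(w|p) ≥ 3`. [cite: SilvermanAEC2009, Prop. VII.5.1(b)] -/
theorem two_le_ramificationIdx_of_addv_of_hasGoodReductionAt (hp5 : 5 ≤ p) (hadd : Addv W p)
    (hj : 0 ≤ padicValRat p W.j) (hw : (p : 𝓞 F) ∈ w.asIdeal)
    (hgood : (W.baseChange F).HasGoodReductionAt w) :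
    2 ≤ (Ideal.span {(p : ℤ)}).ramificationIdx' w.asIdeal := by
  have hdvd := semistabilityIndex_dvd_ramificationIdx_of_hasGoodReductionAt W p F w hw hgood
  have hne1 := semistabilityIndex_ne_one_of_addv W p hp5 hadd hj
  haveI := liesOver_span_of_natCast_mem p F w hw
  have hpos : 0 < (Ideal.span {(p : ℤ)}).ramificationIdx' w.asIdeal :=
    Nat.pos_of_ne_zero (Ideal.IsDedekindDomain.ramificationIdx'_ne_zero_of_liesOver w.asIdeal (by
      rw [Ne, Ideal.span_singleton_eq_bot]; exact_mod_cast hp.out.ne_zero))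
  have h2 : 2 ≤ semistabilityIndex W p := by
    by_contra hlt
    rw [not_le] at hlt
    interval_cases hsi : semistabilityIndex W p
    · have h12 := semistabilityIndex_dvd_twelve W p
      rw [hsi] at h12
      norm_num at h12
    · exact hne1 rfl
  exact h2.trans (Nat.le_of_dvd hpos hdvd)

end Summit.BirchSwinnertonDyer.Rank1Residual.Additive

end
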